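import Literature.MathematicalPhysics.QuantumLattice.GibbsSectorWeightTransfer
import Summits.HubbardSuperconductivity.HubbardSuperconductivity.Theorems.ThermalWedgeTwSeededEnsembleEquivalenceRSharpSectorEntropy
import Summits.HubbardSuperconductivity.HubbardSuperconductivity.Theorems.ThermalWedgeTwSeededEnsembleEquivalenceSeedCommutator
import Literature.MathematicalPhysics.QuantumLattice.HubbardCommutatorBound

/-!
# Crux `TwSeededEnsembleEquivalenceR` (stmt-HubbardSuperconductivity-15581), line `cold-floor-collapse` (slug `Sketch`),
# skeleton v8 (block two-phase pinning) — registered stub `stub_sectorWeightLipschitz`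

Support file (`--supports stmt-HubbardSuperconductivity-15581`; sorry-free; no definition).

**Sector weights of the seeded grand-canonical torus are log-Lipschitz in the particle number at finite `β`.**
For `K = K_L(μ) = hubbardTorusWith 2 L 1 U μ − (g/L²) Δ_dᴴΔ_d` (Hermitian, `tw_isHermitian_seededGC`; particle-number
conserving, `tw_preservesSectors_seededGC`) and `W(N) = Σ_{|s| = N} Re (e^{−βK})_{ss}`:
`(2L² − N) W(N) ≤ (N+1) e^{βC} W(N+1)` and `(N+1) W(N+1) ≤ (2L² − N) e^{βC} W(N)` whenever `L² ≤ 2N` and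
`2(N+1) ≤ 3L²`, with `C = 4r`, `r = 18(2 + |U| + 2|μ|) + g C_seed` the uniform bound on `‖[K, c_o]‖`, `‖[K, c†_o]‖`
(`norm_commutator_hubbardTorusWith_{creation,annihilation}_le`, `stub_seedCommutator`), independent of `β, L, N`.
This is `sectorWeight_orbitSum_transfer` (Literature/MathematicalPhysics/QuantumLattice/GibbsSectorWeightTransfer: orbit-sum
trial vectors `c†_o P_N u_i` / `c_o P_{N+1} u_i` in an eigenbasis of `K`, Jensen for their spectral weights, CAR frame
identities) with `|ι| = 2L²` and the window arithmetic `2L²/(2L² − N) ≤ 4`, `2L²/(N+1) ≤ 4`.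
(Bratteli–Robinson II §5.2–5.3; Ruelle (1969) §3.)
-/

set_option linter.dupNamespace false

namespace Summit.HubbardSuperconductivity.HubbardSuperconductivity.Theorems.TwSeededEnsembleEquivalenceR.ColdFloorLine

open Matrix Filter Topology Finset Literature.MathematicalPhysics.QuantumLattice
open Literature.Barriers.HubbardSuperconductivity Literature.Probability.LatticeModels
open scoped ComplexOrder Matrix.Norms.L2Operator

noncomputable section

/-- (registered stub `stub_sectorWeightLipschitz` of skeleton v8; statement verbatim — see Lines/Sketch.lean for the docstring) -/
theorem stub_sectorWeightLipschitz :
    ∀ (U g μ : ℝ), 0 ≤ U → 0 ≤ g → ∃ C : ℝ, 0 ≤ C ∧ ∀ (β : ℝ), 0 < β → ∀ (L : ℕ) [NeZero L] (N : ℕ),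
      L ^ 2 ≤ 2 * N → 2 * (N + 1) ≤ 3 * L ^ 2 →
        (2 * (L : ℝ) ^ 2 - N) * (∑ s ∈ (Finset.univ.filter fun s : Finset (Orb (FermionTorus 2 L)) => s.card = N), (Matrix.gibbsWeight β (hubbardTorusWith 2 L 1 U μ - ((g / (L : ℝ) ^ 2 : ℝ) : ℂ) • ((pairField dWaveFormFactor L)ᴴ * pairField dWaveFormFactor L)) s s).re) ≤
            ((N : ℝ) + 1) * Real.exp (β * C) * (∑ s ∈ (Finset.univ.filter fun s : Finset (Orb (FermionTorus 2 L)) => s.card = (N + 1)), (Matrix.gibbsWeight β (hubbardTorusWith 2 L 1 U μ - ((g / (L : ℝ) ^ 2 : ℝ) : ℂ) • ((pairField dWaveFormFactor L)ᴴ * pairField dWaveFormFactor L)) s s).re) ∧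
        ((N : ℝ) + 1) * (∑ s ∈ (Finset.univ.filter fun s : Finset (Orb (FermionTorus 2 L)) => s.card = (N + 1)), (Matrix.gibbsWeight β (hubbardTorusWith 2 L 1 U μ - ((g / (L : ℝ) ^ 2 : ℝ) : ℂ) • ((pairField dWaveFormFactor L)ᴴ * pairField dWaveFormFactor L)) s s).re) ≤
            (2 * (L : ℝ) ^ 2 - N) * Real.exp (β * C) * (∑ s ∈ (Finset.univ.filter fun s : Finset (Orb (FermionTorus 2 L)) => s.card = N), (Matrix.gibbsWeight β (hubbardTorusWith 2 L 1 U μ - ((g / (L : ℝ) ^ 2 : ℝ) : ℂ) • ((pairField dWaveFormFactor L)ᴴ * pairField dWaveFormFactor L)) s s).re) := by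
  intro U g μ _hU hg
  obtain ⟨Cs, hCs0, hCs⟩ :=
    Summit.HubbardSuperconductivity.HubbardSuperconductivity.Theorems.TwSeededEnsembleEquivalence.ExposedDensity.stub_seedCommutator
  set r : ℝ := 18 * (2 + |U| + 2 * |μ|) + g * Cs with hr
  have hr0 : 0 ≤ r := by positivity
  refine ⟨4 * r, by positivity, ?_⟩
  intro β hβ L _ N hLN hNL
  set K := hubbardTorusWith 2 L 1 U μ - ((g / (L : ℝ) ^ 2 : ℝ) : ℂ) •
    ((pairField dWaveFormFactor L)ᴴ * pairField dWaveFormFactor L) with hKdef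
  have hKh : K.IsHermitian := tw_isHermitian_seededGC L U μ g
  have hL2 : (0 : ℝ) < (L : ℝ) ^ 2 := by
    have := NeZero.pos L
    positivity
  have hs : 0 ≤ g / (L : ℝ) ^ 2 := div_nonneg hg hL2.le
  -- the uniform commutator bound `‖[K, c]‖ ≤ r` for `c ∈ {c_o, c†_o}`
  have hcomm : ∀ c : Matrix (Finset (Orb (FermionTorus 2 L))) (Finset (Orb (FermionTorus 2 L))) ℂ,
      ‖hubbardTorusWith 2 L 1 U μ * c - c * hubbardTorusWith 2 L 1 U μ‖ ≤ 18 * (2 + |U| + 2 * |μ|) →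
      ‖(pairField dWaveFormFactor L)ᴴ * pairField dWaveFormFactor L * c -
          c * ((pairField dWaveFormFactor L)ᴴ * pairField dWaveFormFactor L)‖ ≤ Cs * (L : ℝ) ^ 2 →
      ‖K * c - c * K‖ ≤ r := by
    intro c h1 h2
    have hsplit : K * c - c * K = (hubbardTorusWith 2 L 1 U μ * c - c * hubbardTorusWith 2 L 1 U μ) -
        ((g / (L : ℝ) ^ 2 : ℝ) : ℂ) • ((pairField dWaveFormFactor L)ᴴ * pairField dWaveFormFactor L * c -
          c * ((pairField dWaveFormFactor L)ᴴ * pairField dWaveFormFactor L)) := by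
      simp only [hKdef, sub_mul, mul_sub, smul_mul_assoc, mul_smul_comm, smul_sub]
      abel
    rw [hsplit]
    calc ‖(hubbardTorusWith 2 L 1 U μ * c - c * hubbardTorusWith 2 L 1 U μ) -
            ((g / (L : ℝ) ^ 2 : ℝ) : ℂ) • ((pairField dWaveFormFactor L)ᴴ * pairField dWaveFormFactor L * c -
              c * ((pairField dWaveFormFactor L)ᴴ * pairField dWaveFormFactor L))‖
        ≤ ‖hubbardTorusWith 2 L 1 U μ * c - c * hubbardTorusWith 2 L 1 U μ‖ +
            ‖((g / (L : ℝ) ^ 2 : ℝ) : ℂ) • ((pairField dWaveFormFactor L)ᴴ * pairField dWaveFormFactor L * c -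
              c * ((pairField dWaveFormFactor L)ᴴ * pairField dWaveFormFactor L))‖ := norm_sub_le _ _
      _ ≤ 18 * (2 + |U| + 2 * |μ|) + g / (L : ℝ) ^ 2 * (Cs * (L : ℝ) ^ 2) := by
          rw [norm_smul, Complex.norm_real, Real.norm_of_nonneg hs]
          exact add_le_add h1 (mul_le_mul_of_nonneg_left h2 hs)
      _ = r := by
          rw [hr, div_mul_eq_mul_div, ← mul_assoc, mul_div_cancel_right₀ _ hL2.ne']
  have hc : ∀ o : Orb (FermionTorus 2 L), ‖K * creation o - creation o * K‖ ≤ r := fun o =>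
    hcomm _ (norm_commutator_hubbardTorusWith_creation_le U μ L (ofLex o).1 (ofLex o).2) (hCs L o).2
  have ha : ∀ o : Orb (FermionTorus 2 L), ‖K * annihilation o - annihilation o * K‖ ≤ r := fun o =>
    hcomm _ (norm_commutator_hubbardTorusWith_annihilation_le U μ L (ofLex o).1 (ofLex o).2) (hCs L o).1
  -- particle numbers
  have hcard : Fintype.card (Orb (FermionTorus 2 L)) = 2 * L ^ 2 := card_orb_fermionTorus_two
  have hcardR : (Fintype.card (Orb (FermionTorus 2 L)) : ℝ) = 2 * (L : ℝ) ^ 2 := by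
    rw [hcard]; push_cast; ring
  have hNlt : N < Fintype.card (Orb (FermionTorus 2 L)) := by
    rw [hcard]
    set X := L ^ 2 with hX
    omega
  have hN1 : N + 1 ≤ 2 * L ^ 2 := by
    set X := L ^ 2 with hX
    omega
  -- the generic sector step
  have hstep := sectorWeight_orbitSum_transfer K hKh (fun s s' h => by
      obtain ⟨h1, h2⟩ := tw_preservesSectors_seededGC L U μ g s s' h
      rw [card_eq_upPart_add_downPart s, card_eq_upPart_add_downPart s', h1, h2])
    hβ.le hc ha N hNlt
  rw [hcardR] at hstep
  obtain ⟨h1, h2⟩ := hstep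
  -- positivity of the sector weights
  obtain ⟨-, -, hpos, -⟩ :=
    Summit.HubbardSuperconductivity.HubbardSuperconductivity.Theorems.TwSeededEnsembleEquivalence.ThermalDuality.stub_sectorWeightBasics
      L U g β hβ
  have hW0 := hpos μ N (by omega)
  have hW1 := hpos μ (N + 1) hN1
  -- the exponents: `2L²/(2L² − N) ≤ 4` and `2L²/(N+1) ≤ 4` in the density window
  have hNR : 2 * ((N : ℝ) + 1) ≤ 3 * (L : ℝ) ^ 2 := by exact_mod_cast hNL
  have hLR : (L : ℝ) ^ 2 ≤ 2 * N := by exact_mod_cast hLN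
  have ha0 : 0 < 2 * (L : ℝ) ^ 2 - N := by nlinarith
  have hβr : 0 ≤ β * r := mul_nonneg hβ.le hr0
  have he1 : β * (2 * (L : ℝ) ^ 2 * r) / (2 * (L : ℝ) ^ 2 - N) ≤ β * (4 * r) := by
    rw [div_le_iff₀ ha0]
    have h4 : 2 * (L : ℝ) ^ 2 ≤ 4 * (2 * (L : ℝ) ^ 2 - N) := by linarith
    calc β * (2 * (L : ℝ) ^ 2 * r) = β * r * (2 * (L : ℝ) ^ 2) := by ring
      _ ≤ β * r * (4 * (2 * (L : ℝ) ^ 2 - N)) := mul_le_mul_of_nonneg_left h4 hβr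
      _ = β * (4 * r) * (2 * (L : ℝ) ^ 2 - N) := by ring
  have he2 : β * (2 * (L : ℝ) ^ 2 * r) / ((N : ℝ) + 1) ≤ β * (4 * r) := by
    rw [div_le_iff₀ (by positivity)]
    have h4 : 2 * (L : ℝ) ^ 2 ≤ 4 * ((N : ℝ) + 1) := by linarith
    calc β * (2 * (L : ℝ) ^ 2 * r) = β * r * (2 * (L : ℝ) ^ 2) := by ring
      _ ≤ β * r * (4 * ((N : ℝ) + 1)) := mul_le_mul_of_nonneg_left h4 hβr
      _ = β * (4 * r) * ((N : ℝ) + 1) := by ring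
  refine ⟨?_, ?_⟩
  · calc _ ≤ _ := h1
      _ ≤ Real.exp (β * (4 * r)) *
            (((N : ℝ) + 1) * ∑ s ∈ (Finset.univ.filter fun s : Finset (Orb (FermionTorus 2 L)) => s.card = N + 1),
              (Matrix.gibbsWeight β K s s).re) :=
          mul_le_mul_of_nonneg_right (Real.exp_le_exp.2 he1) (mul_nonneg (by positivity) hW1.le)
      _ = _ := by ring
  · calc _ ≤ _ := h2
      _ ≤ Real.exp (β * (4 * r)) *
            ((2 * (L : ℝ) ^ 2 - N) * ∑ s ∈ (Finset.univ.filter fun s : Finset (Orb (FermionTorus 2 L)) => s.card = N),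
              (Matrix.gibbsWeight β K s s).re) :=
          mul_le_mul_of_nonneg_right (Real.exp_le_exp.2 he2) (mul_nonneg ha0.le hW0.le)
      _ = _ := by ring

end

end Summit.HubbardSuperconductivity.HubbardSuperconductivity.Theorems.TwSeededEnsembleEquivalenceR.ColdFloorLine
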